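import Mathlib
import HarnessLib
import Summits.CriticalPhenomena.PercolationContinuityZ3.Theorems.PercNearOneGluingNoHeavyLowerTailKnQuestion8AntitheticLevels

/-!
# `NoHeavyLowerTail` (crux stmt-CriticalPhenomena-4575), antithetic vdBHK programme: ROOT-EDGE SUBDIVISION against a rest (THEOREM RES)

Support file (seat `prim-ineq-gen-7` gen 39; `--supports stmt-CriticalPhenomena-4575`).  Nothing is asserted about the crux; no `sorry`,
no definitions.  Memo: run/shared/lean/prim/prim-ineq-gen-7/FINDING-RES-g39.md §1–§2 and PROOF-RES-g39.md.

CONTEXT.  For a rooted tree `T = T_G ∨ T_rest` the per-tree inequality `(***)` (FINDING-TREEBLOCK-g25) is a sum over the positions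
`x ∈ R = F_v(T_rest)` of 'cross products' `crossprod^G(Y_x, Y_{ι x})` and certificates (the R-positional form, PROOF-RES §P1; nothing is
un-mixed).  If the leg `T_G = f + g + E″` has a degree-2 neck, the hub structure of `G = F_v(T_G)` over `G′ = F_v(T_G / f)` gives the
decomposition `val_T(Y) ≥ val_{T/f}(Y|F′) + Σ_levels DLOCAL^R` (PROOF-RES §P2): the certificates split EXACTLY over the levels and the
products are un-mixed only inside the new cube `B_{W′}` by Kleitman's lemma — for TWO DIFFERENT quadruples `s = Y_x`, `u = Y_{ι x}`, which
is `AntitheticLevel.mixed_ge_pure` with four independent upper families, recorded below in the two-term 'level' shape that is used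
(`crossLevel_le_mixed`).  THEOREM RES is then the induction on the handle length: if the finite level functional `DLOCAL^R` of the rest is
nonnegative (a SAT / exhaustive lemma per rest, memo §3) and `(***)` holds for the base tree, it holds for every handle length
(`res_induction`, the combinatorial skeleton, with the data types, restriction maps and functionals abstract).
-/

namespace Summit.CriticalPhenomena.PercolationContinuityZ3.Theorems

open Finset

namespace AntitheticRootEdge

variable {α : Type*} [DecidableEq α] [Fintype α]

/-- CROSS LEVEL INEQUALITY (PROOF-RES §P2(a)).  For eight upper families of the cube `2^α` — the bottom/top memberships `A, A⁺` (coordinate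
`a` of the quadruple `s`), `B, B⁺` (coordinate `b` of `s`), `C⁻, C` (coordinate `a′` of the partner quadruple `u`), `D⁻, D` (coordinate `b′`
of `u`) — the 'pure' two-term level product (both factors read at the same level `y`) is dominated by the 'mixed' one (partner read at the
antipodal level `yᶜ`):
`Σ_y [(1_A y − 1_C y)(1_B y − 1_D y) + (1_{A⁺} y − 1_{C⁻} y)(1_{B⁺} y − 1_{D⁻} y)]
   ≤ Σ_y [(1_A y − 1_C yᶜ)(1_B y − 1_D yᶜ) + (1_{A⁺} y − 1_{C⁻} yᶜ)(1_{B⁺} y − 1_{D⁻} yᶜ)]`.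
Two applications of `AntitheticLevel.mixed_ge_pure`; the point is that the partner families are independent of `A, B`. [this work] -/
theorem crossLevel_le_mixed (A Ap B Bp Cm C Dm D : Finset (Finset α))
    (hA : IsUpperSet (A : Set (Finset α))) (hAp : IsUpperSet (Ap : Set (Finset α)))
    (hB : IsUpperSet (B : Set (Finset α))) (hBp : IsUpperSet (Bp : Set (Finset α)))
    (hCm : IsUpperSet (Cm : Set (Finset α))) (hC : IsUpperSet (C : Set (Finset α)))
    (hDm : IsUpperSet (Dm : Set (Finset α))) (hD : IsUpperSet (D : Set (Finset α))) :
    ∑ y : Finset α, (((if y ∈ A then (1:ℤ) else 0) - (if y ∈ C then (1:ℤ) else 0)) *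
        ((if y ∈ B then (1:ℤ) else 0) - (if y ∈ D then (1:ℤ) else 0))
      + ((if y ∈ Ap then (1:ℤ) else 0) - (if y ∈ Cm then (1:ℤ) else 0)) *
        ((if y ∈ Bp then (1:ℤ) else 0) - (if y ∈ Dm then (1:ℤ) else 0)))
    ≤ ∑ y : Finset α, (((if y ∈ A then (1:ℤ) else 0) - (if yᶜ ∈ C then (1:ℤ) else 0)) *
        ((if y ∈ B then (1:ℤ) else 0) - (if yᶜ ∈ D then (1:ℤ) else 0))
      + ((if y ∈ Ap then (1:ℤ) else 0) - (if yᶜ ∈ Cm then (1:ℤ) else 0)) *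
        ((if y ∈ Bp then (1:ℤ) else 0) - (if yᶜ ∈ Dm then (1:ℤ) else 0))) := by
  rw [Finset.sum_add_distrib, Finset.sum_add_distrib]
  have h1 := AntitheticLevel.mixed_ge_pure A C B D hA hC hB hD
  have h2 := AntitheticLevel.mixed_ge_pure Ap Cm Bp Dm hAp hCm hBp hDm
  linarith

/-- THEOREM RES, combinatorial skeleton (PROOF-RES §P3).  Abstract data: for each handle length `h` a type `X h` of admissible data
(up-set quadruples of `F_v((P_h + T₀) ∨ T_rest)`), a functional `val h : X h → ℤ` (the `(***)` value), restriction maps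
`restr h : X (h+1) → X h` (restriction to `F′ ≅ F_v` of the contracted tree) and level terms `lev h : X (h+1) → ℤ` (the sum of the rest's
level functionals `DLOCAL^R` over the levels).  If the hub-step decomposition holds (`val (h+1) Y ≥ val h (restr Y) + lev h Y`), the level
terms are nonnegative (the rest's LEVEL LEMMA) and the base tree satisfies `(***)`, then every handle length does. [this work] -/
theorem res_induction (X : ℕ → Type*) (val : (h : ℕ) → X h → ℤ) (restr : (h : ℕ) → X (h + 1) → X h)
    (lev : (h : ℕ) → X (h + 1) → ℤ)
    (hdec : ∀ h (Y : X (h + 1)), val h (restr h Y) + lev h Y ≤ val (h + 1) Y)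
    (hlev : ∀ h (Y : X (h + 1)), 0 ≤ lev h Y)
    (hbase : ∀ Y : X 0, 0 ≤ val 0 Y) :
    ∀ h (Y : X h), 0 ≤ val h Y := by
  intro h
  induction h with
  | zero => exact hbase
  | succ n ih =>
      intro Y
      have h1 := hdec n Y
      have h2 := hlev n Y
      have h3 := ih (restr n Y)
      linarith

/-- ONE-STEP form of THEOREM RES (PROOF-RES §P2–§P3): the hub-step decomposition `val Y ≥ val′ (restr Y) + lev Y`, the rest's level
lemma `lev ≥ 0` and `(***)` for the contracted tree `T/f` (`val′ ≥ 0`) give `(***)` for `T`. [this work] -/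
theorem res_step {X X' : Type*} (val : X → ℤ) (val' : X' → ℤ) (restr : X → X') (lev : X → ℤ)
    (hdec : ∀ Y, val' (restr Y) + lev Y ≤ val Y) (hlev : ∀ Y, 0 ≤ lev Y) (hbase : ∀ Y', 0 ≤ val' Y') :
    ∀ Y, 0 ≤ val Y := by
  intro Y
  have h1 := hdec Y
  have h2 := hlev Y
  have h3 := hbase (restr Y)
  linarith

/-! ### Appended (gen 39, later the same day): the one-cube Kleitman step that places RES above `HUB` (memo §2b, PROOF-RES §P6)

For a rest position `x` with partner `ιx`, the level rows of the four coordinates are monotone on the G-level pair `{B′ < T′}`;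
the CROSS product of the fully mixed level functional reads the partner at the antipodal slot, the `HUB` product (`PHIPROD`, g32)
reads it at the same slot.  Per position the cross form dominates — Kleitman's lemma on the one-dimensional cube, here a finite
check over the monotone 0/1 data (`[x]` below is `if x then 1 else 0`). -/

/-- ONE-CUBE STEP (PROOF-RES §P6(b)).  For 0/1 data monotone on the pair `B′ ≤ T′` — memberships `aB ≤ aT`, `bB ≤ bT` of the position and
`a'B ≤ a'T`, `b'B ≤ b'T` of its partner — the cross level product dominates the pure (HUB) one:
`(aB − a'T)(bB − b'T) + (aT − a'B)(bT − b'B) ≥ (aB − a'B)(bB − b'B) + (aT − a'T)(bT − b'T)`.  Summed over positions this is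
`Σ_x CROSSPHIPROD(L_x, L_{ιx}) ≥ prod^R(B) + prod^R(T)`, the product half of `DLOCAL^R ≥ HUB^R_0(·;1,1)`. [this work] -/
theorem crossPhiprod_ge_phiprod (aB aT a'B a'T bB bT b'B b'T : Bool)
    (ha : aB ≤ aT) (ha' : a'B ≤ a'T) (hb : bB ≤ bT) (hb' : b'B ≤ b'T) :
    ((if aB then (1:ℤ) else 0) - (if a'B then (1:ℤ) else 0)) * ((if bB then (1:ℤ) else 0) - (if b'B then (1:ℤ) else 0))
        + ((if aT then (1:ℤ) else 0) - (if a'T then (1:ℤ) else 0)) * ((if bT then (1:ℤ) else 0) - (if b'T then (1:ℤ) else 0))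
      ≤ ((if aB then (1:ℤ) else 0) - (if a'T then (1:ℤ) else 0)) * ((if bB then (1:ℤ) else 0) - (if b'T then (1:ℤ) else 0))
        + ((if aT then (1:ℤ) else 0) - (if a'B then (1:ℤ) else 0)) * ((if bT then (1:ℤ) else 0) - (if b'B then (1:ℤ) else 0)) := by
  revert aB aT a'B a'T bB bT b'B b'T
  decide

/-! ### Appended (gen 39): the pointwise lemma of THEOREM RR (memo §2c) — 'root leaves are free' for stars, averaged form

On `B_{s+1} = B_s × {0 < 1}` a certificate of the upper fibre cube that `B_{s+1}` must re-route through the lower fibre may be lost;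
the lemma below says that at each antipodal position pair such a loss is paid for either by a certificate gained in the lower fibre or
by an element of `A⁻ ∩ B⁻` at the lower fibre — a finite statement in the sixteen fibre bits at the two positions, independent of `s`.
Summing it over positions and using `CUBE ≥ #(A⁻ ∩ B⁻)` (the proof of the cube charge inequality) gives THEOREM RR of the memo:
`t_{s+1} + 2·#Cert_{s+1} ≥ #Cert_s(·|0) + #Cert_s(·|1)` for every `s`. -/

set_option synthInstance.maxSize 1000000 in
set_option synthInstance.maxHeartbeats 400000 in
/-- POINTWISE RE-ROUTING LEMMA (THEOREM RR, memo §2c).  Bits at position `p`: `a0 ≤ a1, a'0 ≤ a'1, b0 ≤ b1, b'0 ≤ b'1` (fibres 0 ⊆ 1 of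
the four up-sets) and the same (primed with `q`) at the antipodal position `p̄`.  Certificates (type 1 ∨ type 2) with routes `r` and
memberships `m`: `(ra ∧ ¬ma' ∧ ¬mb ∧ rb') ∨ (¬ma ∧ ra' ∧ rb ∧ ¬mb')`.  `fib c` = fibre-`c` certificate at `p` (routes from `(p̄, c)`),
`big c` = cube certificate at `(p, c)` (routes from `(p̄, 1−c)`).  Then a lost upper certificate (`fib 1 ∧ ¬big 1`) implies a gained lower
certificate (`big 0 ∧ ¬fib 0`) or `(p,0) ∈ A⁻ ∩ B⁻` (`¬a0 ∧ ¬b0` at `p`, `a'1 ∧ b'1` at `p̄`). [this work] -/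
theorem reroute_pointwise : ∀ (a0 a1 a'0 a'1 b0 b1 b'0 b'1 qa0 qa1 qa'0 qa'1 qb0 qb1 qb'0 qb'1 : Bool),
    (a0 = true → a1 = true) → (a'0 = true → a'1 = true) → (b0 = true → b1 = true) → (b'0 = true → b'1 = true) →
    (qa0 = true → qa1 = true) → (qa'0 = true → qa'1 = true) → (qb0 = true → qb1 = true) → (qb'0 = true → qb'1 = true) →
    -- loss at (p,1): fibre-1 certificate (routes qa1,qa'1,qb1,qb'1) but no cube certificate (routes qa0,qa'0,qb0,qb'0)
    (((qa1 ∧ ¬ a'1 ∧ ¬ b1 ∧ qb'1) ∨ (¬ a1 ∧ qa'1 ∧ qb1 ∧ ¬ b'1)) ∧ ¬ ((qa0 ∧ ¬ a'1 ∧ ¬ b1 ∧ qb'0) ∨ (¬ a1 ∧ qa'0 ∧ qb0 ∧ ¬ b'1))) →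
    -- gain at (p,0): cube certificate (routes from (p̄,1)) but no fibre-0 certificate (routes from (p̄,0)) — or (p,0) ∈ A⁻∩B⁻
    ((((qa1 ∧ ¬ a'0 ∧ ¬ b0 ∧ qb'1) ∨ (¬ a0 ∧ qa'1 ∧ qb1 ∧ ¬ b'0)) ∧ ¬ ((qa0 ∧ ¬ a'0 ∧ ¬ b0 ∧ qb'0) ∨ (¬ a0 ∧ qa'0 ∧ qb0 ∧ ¬ b'0)))
      ∨ (¬ a0 ∧ ¬ b0 ∧ qa'1 ∧ qb'1)) := by
  decide

end AntitheticRootEdge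

end Summit.CriticalPhenomena.PercolationContinuityZ3.Theorems
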